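import Summits.ResolutionOfSingularities.ResolutionOfSingularities.Theorems.PurelyInseparableDim4Target
import Literature.AlgebraicGeometry.Resolution.CentreBlowupOrdAlongBasics
import Literature.AlgebraicGeometry.Resolution.PointBlowupKangaroo
import HarnessLib

/-!
# A MODE-1h 2-cycle in class (4,1), `p = q = 2` (crit-1 K-A-01): `¬ Terminates1h 2 2`

[OURS · counted 0] **Negative result about OUR candidate frame** (`PIDim4.Terminates1h`: MODE 1h =
cardinality-first coordinate-centre rule with free ties, WORD #10 of cell `res-dim4-pi`) — nothing about
resolution of singularities. Found and checked by res-dim4-crit-1 (K-A-01), replayed K = A ∧ B ∧ C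
(desk WORD #17 (a), K-S1-1 of the res-dim4-pi census); filed by res-dim4-typ-1 (brick TY-0b, DR-157-D).
Supports stmt-ResolutionOfSingularities-16155 (helper). bears_on: LADDER-RESOLUTION:D157-DOOR2 (res-dim4-pi).

`F₀ = x₂x₃x₄³ + x₂x₃²x₄² + x₁x₂x₃³x₄`, `F₁ = x₂x₃²x₄² + x₂x₃³x₄ + x₁x₂x₃x₄³` (= `F₀` with `x₃ ↔ x₄`);
`s₁ = (F₁, 0, {x₁})`, `s₂ = (F₀, 0, {x₁})`.  `s₁ ⟶ s₂` by the MODE-1h centre `S = {x₁,x₃}`, chart `x₁`,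
origin; `s₂ ⟶ s₁` by `S = {x₁,x₄}`, chart `x₁`, origin.  Hence an infinite MODE-1h chain over `𝔽₂`, so
`Terminates1h 2 2`, `Terminates1hQuestion`, `SecondaryInvariantExists 2 2` are false as stated.
Variables `x₁..x₄` are `Fin 4 = 0..3`.  Nothing here proves resolution in dim ≥ 4 / char p; OURS; counted 0.
-/

set_option linter.dupNamespace false -- mandated namespace of this single-conjunct summit

noncomputable section

namespace Summit.ResolutionOfSingularities.ResolutionOfSingularities.Theorems.PIDim4

namespace Mode1hTwoCycle

open MvPolynomial Finset
open Literature.AlgebraicGeometry.Resolution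
open Literature.AlgebraicGeometry.Resolution.Hauser2010
open Literature.AlgebraicGeometry.Resolution.CentreBlowup

/-- The field `𝔽₂`. [folklore] -/
abbrev K2 : Type := ZMod 2

/-- exponent of `x₂x₃x₄³`. [folklore] -/
def eA : Fin 4 →₀ ℕ := Finsupp.equivFunOnFinite.symm ![0, 1, 1, 3]
/-- exponent of `x₂x₃²x₄²`. [folklore] -/
def eB : Fin 4 →₀ ℕ := Finsupp.equivFunOnFinite.symm ![0, 1, 2, 2]
/-- exponent of `x₁x₂x₃³x₄`. [folklore] -/
def eC : Fin 4 →₀ ℕ := Finsupp.equivFunOnFinite.symm ![1, 1, 3, 1]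
/-- exponent of `x₂x₃³x₄`. [folklore] -/
def eA' : Fin 4 →₀ ℕ := Finsupp.equivFunOnFinite.symm ![0, 1, 3, 1]
/-- exponent of `x₁x₂x₃x₄³`. [folklore] -/
def eC' : Fin 4 →₀ ℕ := Finsupp.equivFunOnFinite.symm ![1, 1, 1, 3]

/-- Pointwise values of `eA`. -/ @[simp] theorem eA_apply (i : Fin 4) : eA i = ![0, 1, 1, 3] i := rfl
/-- Pointwise values of `eB`. -/ @[simp] theorem eB_apply (i : Fin 4) : eB i = ![0, 1, 2, 2] i := rfl
/-- Pointwise values of `eC`. -/ @[simp] theorem eC_apply (i : Fin 4) : eC i = ![1, 1, 3, 1] i := rfl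
/-- Pointwise values of `eA'`. -/ @[simp] theorem eA'_apply (i : Fin 4) : eA' i = ![0, 1, 3, 1] i := rfl
/-- Pointwise values of `eC'`. -/ @[simp] theorem eC'_apply (i : Fin 4) : eC' i = ![1, 1, 1, 3] i := rfl

/-- Exponents differing at one index are different. -/
private theorem ne_of_apply_ne' {d e : Fin 4 →₀ ℕ} (i : Fin 4) (h : d i ≠ e i) : d ≠ e :=
  fun hde => h (by rw [hde])

/-- `eA ≠ eB`. -/ theorem eA_ne_eB : eA ≠ eB := ne_of_apply_ne' 2 (by simp)
/-- `eA ≠ eC`. -/ theorem eA_ne_eC : eA ≠ eC := ne_of_apply_ne' 0 (by simp)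
/-- `eB ≠ eC`. -/ theorem eB_ne_eC : eB ≠ eC := ne_of_apply_ne' 0 (by simp)
/-- `eB ≠ eA'`. -/ theorem eB_ne_eA' : eB ≠ eA' := ne_of_apply_ne' 2 (by simp)
/-- `eB ≠ eC'`. -/ theorem eB_ne_eC' : eB ≠ eC' := ne_of_apply_ne' 0 (by simp)
/-- `eA' ≠ eC'`. -/ theorem eA'_ne_eC' : eA' ≠ eC' := ne_of_apply_ne' 0 (by simp)

/-- `F₀ = x₂x₃x₄³ + x₂x₃²x₄² + x₁x₂x₃³x₄` over `𝔽₂`. [folklore] -/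
def F0 : MvPolynomial (Fin 4) K2 := monomial eA 1 + monomial eB 1 + monomial eC 1
/-- `F₁ = x₂x₃²x₄² + x₂x₃³x₄ + x₁x₂x₃x₄³` over `𝔽₂`. [folklore] -/
def F1 : MvPolynomial (Fin 4) K2 := monomial eB 1 + monomial eA' 1 + monomial eC' 1

/-- `s₁ = (F₁, r = 0, exc = {x₁})`. [folklore] -/
def s1 : State K2 := ⟨F1, 0, {0}⟩
/-- `s₂ = (F₀, r = 0, exc = {x₁})`. [folklore] -/
def s2 : State K2 := ⟨F0, 0, {0}⟩

/-- the centre `V(z, x₁, x₃)`. [folklore] -/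
def S13 : Finset (Fin 4) := {0, 2}
/-- the centre `V(z, x₁, x₄)`. [folklore] -/
def S14 : Finset (Fin 4) := {0, 3}

/-- Degree in the centre variables `{x₁, x₃}`. -/
theorem degIn_S13 (d : Fin 4 →₀ ℕ) : degIn S13 d = d 0 + d 2 := degIn_pair (by decide) d
/-- Degree in the centre variables `{x₁, x₄}`. -/
theorem degIn_S14 (d : Fin 4 →₀ ℕ) : degIn S14 d = d 0 + d 3 := degIn_pair (by decide) d

/-! ## coefficients -/

/-- Coefficients of `F₀`. -/
theorem coeff_F0 (d : Fin 4 →₀ ℕ) :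
    coeff d F0 = (if eA = d then 1 else 0) + (if eB = d then 1 else 0) + (if eC = d then 1 else 0) := by
  simp only [F0, coeff_add, coeff_monomial]

/-- Coefficients of `F₁`. -/
theorem coeff_F1 (d : Fin 4 →₀ ℕ) :
    coeff d F1 = (if eB = d then 1 else 0) + (if eA' = d then 1 else 0) + (if eC' = d then 1 else 0) := by
  simp only [F1, coeff_add, coeff_monomial]

/-- The coefficient of `x₂x₃x₄³` in `F₀` is `1`. -/
theorem coeff_eA_F0 : coeff eA F0 = 1 := by
  rw [coeff_F0, if_pos rfl, if_neg eA_ne_eB.symm, if_neg eA_ne_eC.symm]; simp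

/-- The coefficient of `x₂x₃²x₄²` in `F₀` is `1`. -/
theorem coeff_eB_F0 : coeff eB F0 = 1 := by
  rw [coeff_F0, if_neg eA_ne_eB, if_pos rfl, if_neg eB_ne_eC.symm]; simp

/-- The coefficient of `x₁x₂x₃³x₄` in `F₀` is `1`. -/
theorem coeff_eC_F0 : coeff eC F0 = 1 := by
  rw [coeff_F0, if_neg eA_ne_eC, if_neg eB_ne_eC, if_pos rfl]; simp

/-- The coefficient of `x₂x₃²x₄²` in `F₁` is `1`. -/
theorem coeff_eB_F1 : coeff eB F1 = 1 := by
  rw [coeff_F1, if_pos rfl, if_neg eB_ne_eA'.symm, if_neg eB_ne_eC'.symm]; simp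

/-- The coefficient of `x₂x₃³x₄` in `F₁` is `1`. -/
theorem coeff_eA'_F1 : coeff eA' F1 = 1 := by
  rw [coeff_F1, if_neg eB_ne_eA', if_pos rfl, if_neg (Ne.symm eA'_ne_eC')]; simp

/-- The coefficient of `x₁x₂x₃x₄³` in `F₁` is `1`. -/
theorem coeff_eC'_F1 : coeff eC' F1 = 1 := by
  rw [coeff_F1, if_neg eB_ne_eC', if_neg eA'_ne_eC', if_pos rfl]; simp

/-- `F₀ ≠ 0`. -/
theorem F0_ne_zero : F0 ≠ 0 := fun h => by
  have := coeff_eA_F0; rw [h, coeff_zero] at this; exact zero_ne_one this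

/-- `F₁ ≠ 0`. -/
theorem F1_ne_zero : F1 ≠ 0 := fun h => by
  have := coeff_eB_F1; rw [h, coeff_zero] at this; exact zero_ne_one this

/-- No monomial of degree `< 2` in `F₀`. [folklore] -/
theorem coeff_F0_of_degree_lt {d : Fin 4 →₀ ℕ} (hd : d.degree < 2) : coeff d F0 = 0 := by
  have h2 : d 2 ≤ d.degree := Finsupp.le_degree 2 d
  have h3 : d 3 ≤ d.degree := Finsupp.le_degree 3 d
  have hA : eA ≠ d := fun h => by have := congrArg (· 3) h; simp at this; omega
  have hB : eB ≠ d := fun h => by have := congrArg (· 2) h; simp at this; omega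
  have hC : eC ≠ d := fun h => by have := congrArg (· 2) h; simp at this; omega
  rw [coeff_F0, if_neg hA, if_neg hB, if_neg hC]; simp

/-- No monomial of degree `< 2` in `F₁`. [folklore] -/
theorem coeff_F1_of_degree_lt {d : Fin 4 →₀ ℕ} (hd : d.degree < 2) : coeff d F1 = 0 := by
  have h2 : d 2 ≤ d.degree := Finsupp.le_degree 2 d
  have h3 : d 3 ≤ d.degree := Finsupp.le_degree 3 d
  have hB : eB ≠ d := fun h => by have := congrArg (· 2) h; simp at this; omega
  have hA' : eA' ≠ d := fun h => by have := congrArg (· 2) h; simp at this; omega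
  have hC' : eC' ≠ d := fun h => by have := congrArg (· 3) h; simp at this; omega
  rw [coeff_F1, if_neg hB, if_neg hA', if_neg hC']; simp

/-! ## orders along the two centres and along single hyperplanes -/

/-- The support of `F₀` is contained in its three exponents. -/
theorem support_F0_subset : F0.support ⊆ {eA, eB, eC} := by
  intro d hd
  rw [MvPolynomial.mem_support_iff, coeff_F0] at hd
  simp only [Finset.mem_insert, Finset.mem_singleton]
  by_cases hA : d = eA
  · exact Or.inl hA
  by_cases hB : d = eB
  · exact Or.inr (Or.inl hB)
  by_cases hC : d = eC
  · exact Or.inr (Or.inr hC)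
  exfalso
  rw [if_neg (Ne.symm hA), if_neg (Ne.symm hB), if_neg (Ne.symm hC)] at hd
  simp at hd

/-- The support of `F₁` is contained in its three exponents. -/
theorem support_F1_subset : F1.support ⊆ {eB, eA', eC'} := by
  intro d hd
  rw [MvPolynomial.mem_support_iff, coeff_F1] at hd
  simp only [Finset.mem_insert, Finset.mem_singleton]
  by_cases hB : d = eB
  · exact Or.inl hB
  by_cases hA : d = eA'
  · exact Or.inr (Or.inl hA)
  by_cases hC : d = eC'
  · exact Or.inr (Or.inr hC)
  exfalso
  rw [if_neg (Ne.symm hB), if_neg (Ne.symm hA), if_neg (Ne.symm hC)] at hd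
  simp at hd

/-- `ord_{(x₁,x₄)} F₀ = 2`: the centre `V(z,x₁,x₄)` is Hironaka-permissible for `z² + F₀`. -/
theorem ordAlong_S14_F0 : ordAlong S14 F0 = 2 := by
  apply le_antisymm
  · have := ordAlong_le_of_coeff_ne_zero (S := S14) (d := eB) (F := F0) (by rw [coeff_eB_F0]; exact one_ne_zero)
    rw [degIn_S14] at this; simpa using this
  · apply le_ordAlong_of_forall
    intro d hd
    have hd' := support_F0_subset hd
    simp only [Finset.mem_insert, Finset.mem_singleton] at hd'
    rcases hd' with rfl | rfl | rfl <;> simp [degIn_S14]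

/-- `ord_{(x₁,x₃)} F₁ = 2`: the centre `V(z,x₁,x₃)` is Hironaka-permissible for `z² + F₁`. -/
theorem ordAlong_S13_F1 : ordAlong S13 F1 = 2 := by
  apply le_antisymm
  · have := ordAlong_le_of_coeff_ne_zero (S := S13) (d := eB) (F := F1) (by rw [coeff_eB_F1]; exact one_ne_zero)
    rw [degIn_S13] at this; simpa using this
  · apply le_ordAlong_of_forall
    intro d hd
    have hd' := support_F1_subset hd
    simp only [Finset.mem_insert, Finset.mem_singleton] at hd'
    rcases hd' with rfl | rfl | rfl <;> simp [degIn_S13]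

/-- every single hyperplane `x_i = 0` misses equimultiplicity for `F₀`: `ord_{(x_i)} F₀ ≤ 1`. [folklore] -/
theorem ordAlong_singleton_F0 (i : Fin 4) : ordAlong {i} F0 ≤ 1 := by
  fin_cases i
  · have := ordAlong_le_of_coeff_ne_zero (S := {(0 : Fin 4)}) (d := eA) (F := F0) (by rw [coeff_eA_F0]; exact one_ne_zero)
    rw [degIn_singleton] at this; exact le_trans this (by simp)
  · have := ordAlong_le_of_coeff_ne_zero (S := {(1 : Fin 4)}) (d := eA) (F := F0) (by rw [coeff_eA_F0]; exact one_ne_zero)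
    rw [degIn_singleton] at this; exact le_trans this (by simp)
  · have := ordAlong_le_of_coeff_ne_zero (S := {(2 : Fin 4)}) (d := eA) (F := F0) (by rw [coeff_eA_F0]; exact one_ne_zero)
    rw [degIn_singleton] at this; exact le_trans this (by simp)
  · have := ordAlong_le_of_coeff_ne_zero (S := {(3 : Fin 4)}) (d := eC) (F := F0) (by rw [coeff_eC_F0]; exact one_ne_zero)
    rw [degIn_singleton] at this; exact le_trans this (by simp)

/-- every single hyperplane `x_i = 0` misses equimultiplicity for `F₁`: `ord_{(x_i)} F₁ ≤ 1`. [folklore] -/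
theorem ordAlong_singleton_F1 (i : Fin 4) : ordAlong {i} F1 ≤ 1 := by
  fin_cases i
  · have := ordAlong_le_of_coeff_ne_zero (S := {(0 : Fin 4)}) (d := eB) (F := F1) (by rw [coeff_eB_F1]; exact one_ne_zero)
    rw [degIn_singleton] at this; exact le_trans this (by simp)
  · have := ordAlong_le_of_coeff_ne_zero (S := {(1 : Fin 4)}) (d := eB) (F := F1) (by rw [coeff_eB_F1]; exact one_ne_zero)
    rw [degIn_singleton] at this; exact le_trans this (by simp)
  · have := ordAlong_le_of_coeff_ne_zero (S := {(2 : Fin 4)}) (d := eC') (F := F1) (by rw [coeff_eC'_F1]; exact one_ne_zero)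
    rw [degIn_singleton] at this; exact le_trans this (by simp)
  · have := ordAlong_le_of_coeff_ne_zero (S := {(3 : Fin 4)}) (d := eA') (F := F1) (by rw [coeff_eA'_F1]; exact one_ne_zero)
    rw [degIn_singleton] at this; exact le_trans this (by simp)

/-- A nonempty `S'` of cardinality `< 2` is a singleton. [folklore] -/
private theorem eq_singleton_of_card_lt_two {S' : Finset (Fin 4)} (hne : S'.Nonempty) (hlt : S'.card < 2) :
    ∃ i, S' = {i} := by
  have h1 : S'.card = 1 := by have := Finset.card_pos.mpr hne; omega
  exact Finset.card_eq_one.mp h1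

/-- `V(z,x₁,x₄)` is a MODE-1h centre for `F₀`. [folklore] -/
theorem isMode1hCentre_S14_F0 : IsMode1hCentre 2 S14 F0 := by
  refine ⟨⟨⟨0, by simp [S14]⟩, by rw [ordAlong_S14_F0]; rfl⟩, fun S' hS' => ?_⟩
  by_contra hlt
  rw [not_le] at hlt
  have hcard : S14.card = 2 := by rw [S14, Finset.card_pair (by decide)]
  rw [hcard] at hlt
  obtain ⟨i, rfl⟩ := eq_singleton_of_card_lt_two hS'.1 hlt
  have h := le_trans hS'.2 (ordAlong_singleton_F0 i)
  norm_num at h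

/-- `V(z,x₁,x₃)` is a MODE-1h centre for `F₁`. [folklore] -/
theorem isMode1hCentre_S13_F1 : IsMode1hCentre 2 S13 F1 := by
  refine ⟨⟨⟨0, by simp [S13]⟩, by rw [ordAlong_S13_F1]; rfl⟩, fun S' hS' => ?_⟩
  by_contra hlt
  rw [not_le] at hlt
  have hcard : S13.card = 2 := by rw [S13, Finset.card_pair (by decide)]
  rw [hcard] at hlt
  obtain ⟨i, rfl⟩ := eq_singleton_of_card_lt_two hS'.1 hlt
  have h := le_trans hS'.2 (ordAlong_singleton_F1 i)
  norm_num at h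

/-! ## the chart transforms -/

/-- `x₁`-chart of `Bl_{V(z,x₁,x₄)}` on the exponent `eA`. -/
theorem chartExponent_S14_eA : chartExponent 2 S14 0 eA = eC' := by
  rw [chartExponent_eq_iff, degIn_S14]; refine ⟨by simp, fun i hi => ?_⟩; fin_cases i <;> simp_all
/-- `x₁`-chart of `Bl_{V(z,x₁,x₄)}` on the exponent `eB`. -/
theorem chartExponent_S14_eB : chartExponent 2 S14 0 eB = eB := by
  rw [chartExponent_eq_iff, degIn_S14]; refine ⟨by simp, fun i hi => ?_⟩; fin_cases i <;> simp_all
/-- `x₁`-chart of `Bl_{V(z,x₁,x₄)}` on the exponent `eC`. -/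
theorem chartExponent_S14_eC : chartExponent 2 S14 0 eC = eA' := by
  rw [chartExponent_eq_iff, degIn_S14]; refine ⟨by simp, fun i hi => ?_⟩; fin_cases i <;> simp_all
/-- `x₁`-chart of `Bl_{V(z,x₁,x₃)}` on the exponent `eB`. -/
theorem chartExponent_S13_eB : chartExponent 2 S13 0 eB = eB := by
  rw [chartExponent_eq_iff, degIn_S13]; refine ⟨by simp, fun i hi => ?_⟩; fin_cases i <;> simp_all
/-- `x₁`-chart of `Bl_{V(z,x₁,x₃)}` on the exponent `eA'`. -/
theorem chartExponent_S13_eA' : chartExponent 2 S13 0 eA' = eC := by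
  rw [chartExponent_eq_iff, degIn_S13]; refine ⟨by simp, fun i hi => ?_⟩; fin_cases i <;> simp_all
/-- `x₁`-chart of `Bl_{V(z,x₁,x₃)}` on the exponent `eC'`. -/
theorem chartExponent_S13_eC' : chartExponent 2 S13 0 eC' = eA := by
  rw [chartExponent_eq_iff, degIn_S13]; refine ⟨by simp, fun i hi => ?_⟩; fin_cases i <;> simp_all

/-- `x₁`-chart of the blow-up of `V(z,x₁,x₄)` sends `F₀` to `F₁`. [folklore] -/
theorem chartTransform_S14_F0 : chartTransform 2 S14 0 F0 = F1 := by
  rw [F0, chartTransform_add, chartTransform_add, chartTransform_monomial, chartTransform_monomial,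
    chartTransform_monomial, chartExponent_S14_eA, chartExponent_S14_eB, chartExponent_S14_eC, F1]
  abel

/-- `x₁`-chart of the blow-up of `V(z,x₁,x₃)` sends `F₁` to `F₀`. [folklore] -/
theorem chartTransform_S13_F1 : chartTransform 2 S13 0 F1 = F0 := by
  rw [F1, chartTransform_add, chartTransform_add, chartTransform_monomial, chartTransform_monomial,
    chartTransform_monomial, chartExponent_S13_eB, chartExponent_S13_eA', chartExponent_S13_eC', F0]
  abel

/-- An exponent with an odd entry is not a square exponent. -/
private theorem not_pth_of_odd {d : Fin 4 →₀ ℕ} (i : Fin 4) (h : d i = 1 ∨ d i = 3) :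
    ¬ IsPthPowerExponent 2 d := fun hd => by
  have := (isPthPowerExponent_iff 2 d).mp hd i; omega

/-- `F₀` is clean (no square monomials). [folklore] -/
theorem deletePthPowers_F0 : deletePthPowers 2 F0 = F0 := by
  rw [F0, deletePthPowers_add, deletePthPowers_add, deletePthPowers_monomial, deletePthPowers_monomial,
    deletePthPowers_monomial, if_neg (not_pth_of_odd 1 (by simp)), if_neg (not_pth_of_odd 1 (by simp)),
    if_neg (not_pth_of_odd 1 (by simp))]

/-- `F₁` is clean (no square monomials). [folklore] -/
theorem deletePthPowers_F1 : deletePthPowers 2 F1 = F1 := by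
  rw [F1, deletePthPowers_add, deletePthPowers_add, deletePthPowers_monomial, deletePthPowers_monomial,
    deletePthPowers_monomial, if_neg (not_pth_of_odd 1 (by simp)), if_neg (not_pth_of_odd 1 (by simp)),
    if_neg (not_pth_of_odd 1 (by simp))]

/-! ## the two steps -/

/-- The transform of `s₂` at the origin of the `x₁`-chart of `Bl_{V(z,x₁,x₄)}` is `F₁`. -/
theorem pointTransform_s2 : pointTransform 2 S14 0 0 s2 = F1 := by
  rw [pointTransform, PointBlowup.translate_zero]; exact chartTransform_S14_F0

/-- The transform of `s₁` at the origin of the `x₁`-chart of `Bl_{V(z,x₁,x₃)}` is `F₀`. -/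
theorem pointTransform_s1 : pointTransform 2 S13 0 0 s1 = F0 := by
  rw [pointTransform, PointBlowup.translate_zero]; exact chartTransform_S13_F1

/-- The origin of the `x₁`-chart of `Bl_{V(z,x₁,x₄)}` is an equimultiple point of `s₂`. -/
theorem isEquimultiplePoint_s2 : IsEquimultiplePoint 2 S14 0 0 s2 := by
  intro d _ hdeg; rw [pointTransform_s2]; exact coeff_F1_of_degree_lt hdeg

/-- The origin of the `x₁`-chart of `Bl_{V(z,x₁,x₃)}` is an equimultiple point of `s₁`. -/
theorem isEquimultiplePoint_s1 : IsEquimultiplePoint 2 S13 0 0 s1 := by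
  intro d _ hdeg; rw [pointTransform_s1]; exact coeff_F0_of_degree_lt hdeg

/-- Updating the zero exponent at `0` with `0` gives zero. -/
private theorem update_zero_zero : (0 : Fin 4 →₀ ℕ).update 0 0 = 0 := by
  ext i; rw [Finsupp.update_apply]; split_ifs <;> rfl

/-- **E3**: the step at the origin of the `x₁`-chart of `Bl_{V(z,x₁,x₄)}` maps `s₂` to `s₁`. [folklore] -/
theorem step_s2 : CentreBlowup.step 2 S14 0 0 s2 = s1 := by
  have hF : deletePthPowers 2 (pointTransform 2 S14 0 0 s2) = F1 := by rw [pointTransform_s2, deletePthPowers_F1]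
  have hr : newMult 2 S14 0 0 s2 = 0 := by
    unfold newMult
    rw [show s2.r = 0 from rfl, Finsupp.filter_zero, show s2.F = F0 from rfl, ordAlong_S14_F0]
    exact update_zero_zero
  have he : newExc 0 0 s2 = ({0} : Finset (Fin 4)) := by
    unfold newExc; simp [s2]
  unfold CentreBlowup.step
  rw [hF, hr, he]; rfl

/-- **E2**: the step at the origin of the `x₁`-chart of `Bl_{V(z,x₁,x₃)}` maps `s₁` to `s₂`. [folklore] -/
theorem step_s1 : CentreBlowup.step 2 S13 0 0 s1 = s2 := by
  have hF : deletePthPowers 2 (pointTransform 2 S13 0 0 s1) = F0 := by rw [pointTransform_s1, deletePthPowers_F0]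
  have hr : newMult 2 S13 0 0 s1 = 0 := by
    unfold newMult
    rw [show s1.r = 0 from rfl, Finsupp.filter_zero, show s1.F = F1 from rfl, ordAlong_S13_F1]
    exact update_zero_zero
  have he : newExc 0 0 s1 = ({0} : Finset (Fin 4)) := by
    unfold newExc; simp [s1]
  unfold CentreBlowup.step
  rw [hF, hr, he]; rfl

/-- `s₁ ⟶ s₂` is a MODE-1h step. [folklore] -/
theorem step1h_s1_s2 : Step1h 2 s1 s2 :=
  ⟨S13, isMode1hCentre_S13_F1, 0, 0, by simp [S13], rfl, isEquimultiplePoint_s1,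
    by rw [step_s1]; exact F0_ne_zero, step_s1.symm⟩

/-- `s₂ ⟶ s₁` is a MODE-1h step. [folklore] -/
theorem step1h_s2_s1 : Step1h 2 s2 s1 :=
  ⟨S14, isMode1hCentre_S14_F0, 0, 0, by simp [S14], rfl, isEquimultiplePoint_s2,
    by rw [step_s2]; exact F1_ne_zero, step_s2.symm⟩

/-- The periodic chain `s₁, s₂, s₁, s₂, …`. [folklore] -/
def chain (k : ℕ) : State K2 := if k % 2 = 0 then s1 else s2

/-- Consecutive terms of `chain` are MODE-1h steps. -/
theorem chain_step (k : ℕ) : Step1h 2 (chain k) (chain (k + 1)) := by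
  unfold chain
  by_cases hk : k % 2 = 0
  · rw [if_pos hk, if_neg (by omega)]; exact step1h_s1_s2
  · rw [if_neg hk, if_pos (by omega)]; exact step1h_s2_s1

end Mode1hTwoCycle

open Mode1hTwoCycle in
/-- **MODE 1h does not terminate at `p = q = 2`** (an explicit 2-cycle of MODE-1h steps over `𝔽₂`,
crit-1 K-A-01). [folklore] -/
theorem not_terminates1h_two : ¬ Terminates1h 2 2 := fun h =>
  h K2 ⟨chain, chain_step⟩

/-- Hence the cell's question `Terminates1hQuestion` has the answer NO as stated. [folklore] -/
theorem not_terminates1hQuestion : ¬ Terminates1hQuestion := fun h =>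
  not_terminates1h_two (h 2 Nat.prime_two)

open Mode1hTwoCycle in
/-- No secondary invariant for MODE 1h at `p = q = 2` (a 2-cycle admits no strictly decreasing
well-founded function). [folklore] -/
theorem not_secondaryInvariantExists_two : ¬ SecondaryInvariantExists 2 2 := by
  intro h
  obtain ⟨W, lt, hwf, Φ, hΦ⟩ := h K2
  exact hwf.asymmetric _ _ (hΦ _ _ step1h_s1_s2) (hΦ _ _ step1h_s2_s1)

open Mode1hTwoCycle in
/-- Nor a renaming-invariant one. [folklore] -/
theorem not_secondaryInvariantExistsSym_two : ¬ SecondaryInvariantExistsSym 2 2 := by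
  intro h
  obtain ⟨W, lt, hwf, Φ, hΦ, -⟩ := h K2
  exact hwf.asymmetric _ _ (hΦ _ _ step1h_s1_s2) (hΦ _ _ step1h_s2_s1)

end Summit.ResolutionOfSingularities.ResolutionOfSingularities.Theorems.PIDim4

end
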